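import Literature.Analysis.FluidPDE.PressureGradientCriterionLFour
import Literature.Analysis.FluidPDE.LThetaPressureSliceEstimate
import HarnessLib

/-!
# The pressure-gradient regularity criterion on `ℝ³`, DISCHARGED (Berselli–Galdi / Zhou; Lemarié-Rieusset, Prop. 11.7)

Analysis/FluidPDE proof file (theorems only: no definition, no named fact, no `sorry`).
Search for candidate a priori estimates; no regularity claim. This file PROVES the named fact
`Literature.Analysis.FluidPDE.pressureGradientCriterion` (`GradientRegularityCriteria`;
Berselli–Galdi 2002, Thm. 3.3 / Zhou, as presented in Lemarié-Rieusset 2016, §11.5 Prop. 11.7 with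
`σ = 2`): a classical solution of the unforced Navier–Stokes system on `ℝ³ × [0, T)` which is
Leray–Hopf from `u(0)` and whose pressure gradient lies in `L^s(0, T; L^q)`, `2/s + 3/q = 3`,
`1 < q < ∞`, extends smoothly past `T` — `pressureGradientCriterion_holds`.

The case `1 < q < 3` is `pressureGradientCriterion_of_lt_three` (`PressureGradientCriterionLFour`,
the `L⁴` energy). This file adds the case `3 ≤ q < ∞` (`pressureGradientCriterion_of_three_le`)
by the `L^θ` energy with `θ = 3q - 2` (LR (11.55)–(11.57)), assembled on Tao's classical class
exactly as the `L⁴` case: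
* Step A (`exists_ltheta_le_of_pressureGradient`): on every open interval of `H¹`-regularity the
  `L^θ` energy stays bounded towards the right end — Tao patches (`exists_tao_patch`), the patch
  pressure is the normalised pressure (Stein's bound at exponent `(θ+2)/2`,
  `ae_patch_pressure_bounds_of_le`) with the same gradient as `p`, and the `L^θ` Grönwall
  inequality `ltheta_energy_le_mul_exp` (`LThetaPressureSliceEstimate`) propagates the bound, the
  total weight being `∝ ∫₀ᵀ ‖∇p‖_{L^q}^s < ∞` (`pressureGradient_exponents_three_le`,
  `lintegral_ofReal_rpow_pressureGradient_lt_top_three_le`).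
* Step B (`limsup_eH1NormSq_lt_top_of_ltheta_bound_near`): a uniform `L^θ` bound near `β` puts a
  restart in the Serrin class `L^{2θ/(θ-3)}_t L^θ_x`, whence `limsup_{t→β⁻}‖u‖²_{H¹} < ∞`
  (`limsup_eH1NormSq_lt_top_of_serrin`); the starting slice in `L^θ` is a slice of a Tao patch
  (`exists_mem_Ioo_lintegral_norm_rpow_lt_top`).
* Discharge: Leray continuation + local strong solution + Ladyzhenskaya–Prodi–Serrin + weak–strong
  uniqueness + gluing, verbatim as in `BeiraoDaVeiga1995_gradientCriterion_holds`.
The decay (`HasRapidSpatialDecay`) and pressure-normalisation hypotheses of the fact are not used.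

## References

* [LemarieRieusset2016] P. G. Lemarié-Rieusset, *The Navier–Stokes problem in the 21st century*,
  CRC Press 2016 — §11.5 Prop. 11.7 and its proof (PDF pp. 362–366).
* [BerselliGaldi2002] L. C. Berselli, G. P. Galdi, *Regularity criteria involving the pressure
  for the weak solutions to the Navier–Stokes equations*, Proc. AMS 130 (2002) 3585–3595 —
  Thm. 3.3 (p. 3593).
* [RobinsonRodrigoSadowski2016] J. C. Robinson, J. L. Rodrigo, W. Sadowski, *The
  three-dimensional Navier–Stokes equations*, CUP 2016 — Lemma 8.16, Thm. 8.17, Thm. 6.15.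
* [Tao2011] T. Tao, *Localisation and compactness properties of the Navier–Stokes global
  regularity problem*, Anal. PDE 6 (2013) — §2 (the `H¹` local theory), Lemma 4.1.
-/

noncomputable section

open MeasureTheory Set Function Filter Topology InnerProductSpace
open scoped ENNReal NNReal ContDiff RealInnerProductSpace Laplacian

namespace Literature.Analysis.FluidPDE

/-! ### Exponents and helpers for the case `q ≥ 3` -/

section Exponents

/-- **Exponent bookkeeping, case `q ≥ 3`.** In `ℝ≥0∞`: if `3 ≤ q < ∞` and `2/s + 3/q = 3` then,
with `θ = 3q - 2` (so `q = (θ+2)/3`) and `Θ = 3(θ-1)/(4(θ+2))`: `θ ≥ 4`,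
`ofReal ((θ+2)/3) = q`, `0 < s < ∞` and `s.toReal = 1/(2Θ)` (`= 2q/(3(q-1))`).
[cite: LemarieRieusset2016, §11.5 Prop. 11.7 proof (PDF p. 366)] -/
theorem pressureGradient_exponents_three_le {s q : ℝ≥0∞} (h3q : 3 ≤ q) (hqtop : q < ⊤)
    (hsq : 2 / s + 3 / q = 3) :
    4 ≤ 3 * q.toReal - 2 ∧ ENNReal.ofReal ((3 * q.toReal - 2 + 2) / 3) = q ∧ s ≠ ⊤ ∧ s ≠ 0 ∧
      s.toReal = 1 / (2 * (3 * (3 * q.toReal - 2 - 1) / (4 * (3 * q.toReal - 2 + 2)))) := by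
  have hqtop' : q ≠ ⊤ := hqtop.ne
  have hq0 : q ≠ 0 := (lt_of_lt_of_le (by norm_num) h3q).ne'
  set Q : ℝ := q.toReal with hQ
  have hQ3 : 3 ≤ Q := by
    have h := (ENNReal.toReal_le_toReal (by simp : (3 : ℝ≥0∞) ≠ ⊤) hqtop').2 h3q
    simpa [hQ] using h
  have hQ0 : 0 < Q := by linarith
  refine ⟨by linarith, ?_, ?_⟩
  · have h : (3 * Q - 2 + 2) / 3 = Q := by ring
    rw [h, hQ, ENNReal.ofReal_toReal hqtop']
  -- `s ≠ 0`, `s ≠ ⊤`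
  have hs0 : s ≠ 0 := by
    rintro rfl
    rw [ENNReal.div_zero (by norm_num : (2 : ℝ≥0∞) ≠ 0), top_add] at hsq
    exact absurd hsq ENNReal.top_ne_ofNat
  have h3q' : 3 / q ≠ ⊤ := ENNReal.div_ne_top (by norm_num) hq0
  have hstop : s ≠ ⊤ := by
    intro hs
    rw [hs, ENNReal.div_top, zero_add] at hsq
    have h := congrArg ENNReal.toReal hsq
    rw [ENNReal.toReal_div, ENNReal.toReal_ofNat] at h
    have h' : (3 : ℝ) / Q = 3 := by simpa [hQ] using h
    rw [div_eq_iff hQ0.ne'] at h'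
    nlinarith
  have h2s : 2 / s ≠ ⊤ := ENNReal.div_ne_top (by norm_num) hs0
  set S : ℝ := s.toReal with hS
  have hSpos : 0 < S := ENNReal.toReal_pos hs0 hstop
  have hreal : 2 / S + 3 / Q = 3 := by
    have h := congrArg ENNReal.toReal hsq
    rw [ENNReal.toReal_add h2s h3q', ENNReal.toReal_div, ENNReal.toReal_div, ENNReal.toReal_ofNat,
      ENNReal.toReal_ofNat] at h
    simpa [hS, hQ] using h
  refine ⟨hstop, hs0, ?_⟩
  have hQ1 : 0 < Q - 1 := by linarith
  have h2 : 2 / S = 3 * (Q - 1) / Q := by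
    have : 2 / S = 3 - 3 / Q := by linarith
    rw [this]; field_simp
  rw [div_eq_div_iff hSpos.ne' hQ0.ne'] at h2
  have h3 : S = 2 * Q / (3 * (Q - 1)) := by
    rw [eq_div_iff (by positivity)]; linarith
  rw [h3]
  have h4 : (3 * Q - 2 - 1) = 3 * (Q - 1) := by ring
  have h5 : (3 * Q - 2 + 2) = 3 * Q := by ring
  rw [h4, h5]
  field_simp
  ring

/-- **The Grönwall weight of a member of `L^s_t L^q_x` is finite, case `q ≥ 3`**: for
`3 ≤ q < ∞`, `2/s + 3/q = 3`, `G ∈ L^s((0,T); L^q)` and a constant `M ≥ 0`,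
`∫₀ᵀ (M (‖G(t)‖_{L^q})^{1/2})^{1/Θ} dt < ∞` (`1/(2Θ) = s`), and `G(t) ∈ L^q` for a.e. `t ∈ (0,T)`.
[cite: LemarieRieusset2016, §11.5 Prop. 11.7 proof, (11.57) (PDF p. 366)] -/
theorem lintegral_ofReal_rpow_pressureGradient_lt_top_three_le {X F : Type*} [MeasureSpace X]
    [NormedAddCommGroup F] {s q : ℝ≥0∞} {G : ℝ → X → F} {T : ℝ} (h3q : 3 ≤ q) (hqtop : q < ⊤)
    (hsq : 2 / s + 3 / q = 3) (hS : MemLqLp s q G (Ioo 0 T)) {M : ℝ} (hM : 0 ≤ M) :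
    (∫⁻ t in Ioo 0 T, ENNReal.ofReal
      ((M * Real.sqrt ((eLpNorm (G t) q volume).toReal)) ^
        (1 / (3 * (3 * q.toReal - 2 - 1) / (4 * (3 * q.toReal - 2 + 2))))) < ⊤) ∧
    ∀ᵐ t ∂volume, t ∈ Ioo 0 T → eLpNorm (G t) q volume < ⊤ := by
  obtain ⟨-, -, hstop, hs0, hsΘ⟩ := pressureGradient_exponents_three_le h3q hqtop hsq
  set Θ : ℝ := 3 * (3 * q.toReal - 2 - 1) / (4 * (3 * q.toReal - 2 + 2)) with hΘ
  have hSpos : 0 < s.toReal := ENNReal.toReal_pos hs0 hstop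
  have hΘS : 1 / Θ = 2 * s.toReal := by
    rw [hsΘ]; field_simp
  have hΘ0 : 0 < Θ := by
    have : 0 < 1 / Θ := by rw [hΘS]; positivity
    simpa using this
  set N : ℝ → ℝ := fun t => (eLpNorm (G t) q volume).toReal with hN
  have hN0 : ∀ t, 0 ≤ N t := fun t => ENNReal.toReal_nonneg
  refine ⟨?_, ?_⟩
  · have hlt : ∫⁻ t, ‖N t‖ₑ ^ s.toReal ∂(volume.restrict (Ioo 0 T)) < ⊤ :=
      lintegral_rpow_enorm_lt_top_of_eLpNorm_lt_top hs0 hstop hS.2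
    have hMs : ENNReal.ofReal (M ^ (1 / Θ)) ≠ ⊤ := ENNReal.ofReal_ne_top
    calc ∫⁻ t in Ioo 0 T, ENNReal.ofReal ((M * Real.sqrt (N t)) ^ (1 / Θ))
        = ∫⁻ t in Ioo 0 T, ENNReal.ofReal (M ^ (1 / Θ)) * ‖N t‖ₑ ^ s.toReal := by
          refine lintegral_congr fun t => ?_
          rw [Real.mul_rpow hM (Real.sqrt_nonneg _), ENNReal.ofReal_mul (Real.rpow_nonneg hM _),
            Real.enorm_eq_ofReal (hN0 t), ENNReal.ofReal_rpow_of_nonneg (hN0 t) hSpos.le,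
            Real.sqrt_eq_rpow, ← Real.rpow_mul (hN0 t), hΘS]
          congr 2
          field_simp
    _ = ENNReal.ofReal (M ^ (1 / Θ)) * ∫⁻ t in Ioo 0 T, ‖N t‖ₑ ^ s.toReal :=
          lintegral_const_mul' _ _ hMs
    _ < ⊤ := ENNReal.mul_lt_top ENNReal.ofReal_lt_top hlt
  · have h := hS.1
    rw [ae_restrict_iff' measurableSet_Ioo] at h
    filter_upwards [h] with t ht htI
    exact (ht htI).eLpNorm_lt_top

/-- `(∫‖f‖^Q)^{1/Q} = ‖f‖_{L^Q}` (real number) for `f ∈ L^Q`, `0 < Q`. [folklore] -/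
private theorem rpow_integral_norm_rpow_eq_toReal_eLpNorm {X F : Type*} [MeasureSpace X]
    [NormedAddCommGroup F] {f : X → F} {Q : ℝ} (hQ : 0 < Q)
    (hf : MemLp f (ENNReal.ofReal Q) volume) :
    (∫ x, ‖f x‖ ^ Q) ^ (1 / Q) = (eLpNorm f (ENNReal.ofReal Q) volume).toReal := by
  rw [hf.eLpNorm_eq_integral_rpow_norm ((ENNReal.ofReal_pos.2 hQ).ne') ENNReal.ofReal_ne_top,
    ENNReal.toReal_ofReal hQ.le, ENNReal.toReal_ofReal (Real.rpow_nonneg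
      (integral_nonneg fun x => Real.rpow_nonneg (norm_nonneg _) _) _), one_div]

/-- The gradient of a patch pressure equals that of the represented pressure (copy of the private
lemma of `TaoPatchPressureTransfer`). [folklore] -/
private theorem gradient_patch_pressure_eq' {ν L : ℝ}
    {w : ℝ → EuclideanSpace ℝ (Fin 3) → EuclideanSpace ℝ (Fin 3)}
    {π : ℝ → EuclideanSpace ℝ (Fin 3) → ℝ} (hw : FluidPDE.IsClassicalNSSolutionOn (Icc 0 L) ν 0 w π)
    {S : Set ℝ} {u : ℝ → EuclideanSpace ℝ (Fin 3) → EuclideanSpace ℝ (Fin 3)}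
    {p : ℝ → EuclideanSpace ℝ (Fin 3) → ℝ} (hcl : FluidPDE.IsClassicalNSSolutionOn S ν 0 u p)
    {τ₁ L' : ℝ} (hL' : L' ≤ L) (hS : ∀ t ∈ Ioo 0 L', t + τ₁ ∈ S)
    (heq : ∀ t ∈ Ioo 0 L', u (t + τ₁) = w t)
    {t : ℝ} (ht : t ∈ Ioo 0 L') : gradient (π t) = gradient (p (t + τ₁)) := by
  have h₂ := hcl.comp_add_right τ₁
  have h0 : (fun s => (0 : ℝ → EuclideanSpace ℝ (Fin 3) → EuclideanSpace ℝ (Fin 3)) (s + τ₁)) = 0 :=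
    rfl
  rw [h0] at h₂
  have hnhds : Ioo 0 L' ∈ 𝓝 t := Ioo_mem_nhds ht.1 ht.2
  have hS₁ : Icc 0 L ∈ 𝓝 t := Icc_mem_nhds ht.1 (lt_of_lt_of_le ht.2 hL')
  have hS₂ : (fun s => s + τ₁) ⁻¹' S ∈ 𝓝 t :=
    Filter.mem_of_superset hnhds fun s hs => hS s hs
  have hev : ∀ᶠ s in 𝓝 t, w s = (fun s => u (s + τ₁)) s :=
    Filter.eventually_of_mem hnhds fun s hs => (heq s hs).symm
  funext x
  exact hw.gradient_pressure_eq_of_eventuallyEq h₂ hS₁ hS₂ hev x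

/-- Transfer of an a.e.-in-time property along a time translation. [folklore] -/
private theorem ae_translate_right' {P : ℝ → Prop} (h : ∀ᵐ σ ∂volume, P σ) (τ₁ : ℝ) :
    ∀ᵐ t ∂volume, P (t + τ₁) := by
  have hmp : MeasurePreserving (fun t : ℝ => t + τ₁) volume volume :=
    measurePreserving_add_right volume τ₁
  have h1 : ∀ᵐ y ∂(Measure.map (fun t : ℝ => t + τ₁) volume), P y := by
    rw [hmp.map_eq]; exact h
  exact ae_of_ae_map hmp.measurable.aemeasurable h1

/-- **A bounded `L²` slice is in every `L^θ`, `θ ≥ 2`** (`∫‖v‖^θ ≤ B^{θ-2}∫‖v‖²`). [folklore] -/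
private theorem lintegral_ofReal_norm_rpow_lt_top_of_bound
    {v : EuclideanSpace ℝ (Fin 3) → EuclideanSpace ℝ (Fin 3)} {B : ℝ} (hB : ∀ x, ‖v x‖ ≤ B)
    (hv2 : ∫⁻ x, ‖v x‖ₑ ^ 2 < ⊤) {θ : ℝ} (hθ : 2 ≤ θ) :
    ∫⁻ x, ENNReal.ofReal (‖v x‖ ^ θ) < ⊤ := by
  have hB0 : 0 ≤ B := (norm_nonneg _).trans (hB 0)
  have hpt : ∀ x, ENNReal.ofReal (‖v x‖ ^ θ) ≤ ENNReal.ofReal (B ^ (θ - 2)) * ‖v x‖ₑ ^ 2 := by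
    intro x
    have hsplit : ‖v x‖ ^ θ = ‖v x‖ ^ (θ - 2) * ‖v x‖ ^ 2 := by
      rw [← Real.rpow_natCast (‖v x‖) 2, ← Real.rpow_add' (norm_nonneg _) (by norm_num; linarith)]
      norm_num
    rw [hsplit, ENNReal.ofReal_mul (Real.rpow_nonneg (norm_nonneg _) _), ← ofReal_norm,
      ← ENNReal.ofReal_pow (norm_nonneg _)]
    exact mul_le_mul_left (ENNReal.ofReal_le_ofReal
      (Real.rpow_le_rpow (norm_nonneg _) (hB x) (by linarith))) _
  calc ∫⁻ x, ENNReal.ofReal (‖v x‖ ^ θ) ≤ ∫⁻ x, ENNReal.ofReal (B ^ (θ - 2)) * ‖v x‖ₑ ^ 2 :=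
        lintegral_mono hpt
    _ = ENNReal.ofReal (B ^ (θ - 2)) * ∫⁻ x, ‖v x‖ₑ ^ 2 := lintegral_const_mul' _ _ ENNReal.ofReal_ne_top
    _ < ⊤ := ENNReal.mul_lt_top ENNReal.ofReal_lt_top hv2

end Exponents

/-! ### Step A (`q ≥ 3`): the uniform `L^θ` bound, `θ = 3q - 2` -/

section StepA3

variable {ν T : ℝ} {u₀ : EuclideanSpace ℝ (Fin 3) → EuclideanSpace ℝ (Fin 3)}
  {u : ℝ → EuclideanSpace ℝ (Fin 3) → EuclideanSpace ℝ (Fin 3)}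
  {p : ℝ → EuclideanSpace ℝ (Fin 3) → ℝ}

/-- **Uniform `L^θ` bound towards the right end of an interval of regularity, in the
pressure-gradient class `∇p ∈ L^s_t L^q_x`, `2/s + 3/q = 3`, `3 ≤ q < ∞`, `θ = 3q - 2`**
(Lemarié-Rieusset 2016, Prop. 11.7: "`sup_{0<t<T} ‖u(t)‖_θ < +∞`"). The twin of
`exists_lfour_le_of_pressureGradient` with the `L^θ` Grönwall inequality `ltheta_energy_le_mul_exp`
on the Tao patches; the patch pressure is the normalised pressure (Stein's bound at exponent
`(θ+2)/2`, `ae_patch_pressure_bounds_of_le`) and has the same gradient as `p`.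
[cite: LemarieRieusset2016, §11.5 Prop. 11.7 (PDF pp. 365–366)] [cite: BerselliGaldi2002, Thm. 3.3] -/
theorem exists_ltheta_le_of_pressureGradient {c : ℝ} (hL2 : TaoH1AlmostRegularWith c) (hc : 0 < c)
    (hν : 0 < ν) (hLH : IsLerayHopfOn T ν 0 u₀ u) (hcl : IsClassicalNSSolutionOn (Ico 0 T) ν 0 u p)
    {s q : ℝ≥0∞} (h3q : 3 ≤ q) (hqtop : q < ⊤) (hsq : 2 / s + 3 / q = 3)
    (hLq : ∀ᵐ σ ∂volume, σ ∈ Ioo 0 T → eLpNorm (fun x => gradient (p σ) x) q volume < ⊤)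
    {CS : ℝ≥0}
    (hCS : ∀ v : EuclideanSpace ℝ (Fin 3) → EuclideanSpace ℝ (Fin 3),
      MemLp v (2 * ENNReal.ofReal ((3 * q.toReal - 2 + 2) / 2)) volume →
      eLpNorm (normalisedPressure v) (ENNReal.ofReal ((3 * q.toReal - 2 + 2) / 2)) volume ≤
        CS * eLpNorm v (2 * ENNReal.ofReal ((3 * q.toReal - 2 + 2) / 2)) volume ^ 2)
    (hA : ∫⁻ t in Ioo 0 T, ENNReal.ofReal
      (((3 * q.toReal - 2) * Real.sqrt ((3 * q.toReal - 2 - 2) * CS) *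
          ((SNormLESNormFDerivOfEqConst ℝ (volume : Measure (EuclideanSpace ℝ (Fin 3))) 2 : ℝ) ^ 2 *
            ((3 * q.toReal - 2) ^ 2 / 4)) ^ (9 / (4 * (3 * q.toReal - 2 + 2))) *
        Real.sqrt ((eLpNorm (fun x => gradient (p t) x) q volume).toReal)) ^
        (1 / (3 * (3 * q.toReal - 2 - 1) / (4 * (3 * q.toReal - 2 + 2))))) ≠ ⊤)
    {α β : ℝ} (hα : 0 ≤ α) (hβ : β ≤ T) (hreg : IsH1RegularOn (Ioo α β) u)
    {t₀ : ℝ} (ht₀ : t₀ ∈ Ioo α β)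
    (hy₀ : ∫⁻ x, ENNReal.ofReal (‖u t₀ x‖ ^ (3 * q.toReal - 2)) < ⊤) :
    ∃ K : ℝ≥0∞, K < ⊤ ∧ ∀ t ∈ Ico t₀ β,
      ∫⁻ x, ENNReal.ofReal (‖u t x‖ ^ (3 * q.toReal - 2)) ≤ K := by
  -- exponents (opaque names with defining equations)
  obtain ⟨hθ4', hQq', hstop, hs0, hsΘ'⟩ := pressureGradient_exponents_three_le h3q hqtop hsq
  obtain ⟨θ, hθ⟩ : ∃ θ : ℝ, θ = 3 * q.toReal - 2 := ⟨_, rfl⟩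
  rw [← hθ] at hθ4' hQq' hsΘ' hCS hA hy₀ ⊢
  have hθ4 : 4 ≤ θ := hθ4'
  have hθ0 : 0 < θ := by linarith
  obtain ⟨Θ, hΘ⟩ : ∃ Θ : ℝ, Θ = 3 * (θ - 1) / (4 * (θ + 2)) := ⟨_, rfl⟩
  rw [← hΘ] at hsΘ' hA
  have hΘ0 : 0 < Θ := by rw [hΘ]; exact div_pos (by linarith) (by linarith)
  have hΘ1 : Θ < 1 := by rw [hΘ, div_lt_one (by linarith)]; linarith
  have hQ0 : 0 < (θ + 2) / 3 := by positivity
  obtain ⟨mE, hmE⟩ : ∃ mE : ℝ≥0∞, mE = ENNReal.ofReal ((θ + 2) / 2) := ⟨_, rfl⟩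
  rw [← hmE] at hCS
  have h1mE : 1 < mE := by
    rw [hmE, ← ENNReal.ofReal_one]; exact (ENNReal.ofReal_lt_ofReal_iff (by linarith)).2 (by linarith)
  have hmEtop : mE < ⊤ := by rw [hmE]; exact ENNReal.ofReal_lt_top
  have h2mE : 2 * mE = ENNReal.ofReal (θ + 2) := by
    rw [hmE, ← ENNReal.ofReal_ofNat 2, ← ENNReal.ofReal_mul (by norm_num : (0:ℝ) ≤ 2)]
    congr 1; ring
  -- constants
  obtain ⟨c₁, hc₁⟩ : ∃ c₁ : ℝ, c₁ = θ * Real.sqrt ((θ - 2) * CS) *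
      ((SNormLESNormFDerivOfEqConst ℝ (volume : Measure (EuclideanSpace ℝ (Fin 3))) 2 : ℝ) ^ 2 *
        (θ ^ 2 / 4)) ^ (9 / (4 * (θ + 2))) := ⟨_, rfl⟩
  have hc₁0 : 0 ≤ c₁ := by
    have : 0 ≤ θ - 2 := by linarith
    rw [hc₁]; positivity
  rw [← hc₁] at hA
  obtain ⟨κ, hκ⟩ : ∃ κ : ℝ, κ = Θ * (2 * (1 - Θ)) ^ ((1 - Θ) / Θ) * (ν * θ * (θ - 2)) ^ (-((1 - Θ) / Θ)) :=
    ⟨_, rfl⟩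
  have hκ0 : 0 ≤ κ := by
    have : 0 ≤ 1 - Θ := by linarith
    have : 0 < ν * θ * (θ - 2) := by
      have : 0 < θ - 2 := by linarith
      positivity
    rw [hκ]; positivity
  -- the weight `a σ = ofReal ((c₁ √N σ)^{1/Θ})` and the `L^θ` energy `y`
  obtain ⟨N, hN⟩ : ∃ N : ℝ → ℝ,
      N = fun σ => (eLpNorm (fun x => gradient (p σ) x) q volume).toReal := ⟨_, rfl⟩
  have hN0 : ∀ σ, 0 ≤ N σ := fun σ => by rw [hN]; exact ENNReal.toReal_nonneg
  obtain ⟨a, ha⟩ : ∃ a : ℝ → ℝ≥0∞, a = fun σ => ENNReal.ofReal ((c₁ * Real.sqrt (N σ)) ^ (1 / Θ)) :=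
    ⟨_, rfl⟩
  have hA' : ∫⁻ t in Ioo 0 T, a t ≠ ⊤ := by
    rw [ha, hN]; exact hA
  obtain ⟨y, hy⟩ : ∃ y : ℝ → ℝ≥0∞, y = fun τ => ∫⁻ x, ENNReal.ofReal (‖u τ x‖ ^ θ) :=
    ⟨_, rfl⟩
  obtain ⟨y₀, hy₀def⟩ : ∃ y₀ : ℝ≥0∞, y₀ = y t₀ := ⟨_, rfl⟩
  have hy₀top : y₀ < ⊤ := by rw [hy₀def, hy]; exact hy₀
  refine ⟨ENNReal.ofReal (Real.exp (κ * (∫⁻ σ in Ioo 0 T, a σ).toReal)) * y₀,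
    ENNReal.mul_lt_top ENNReal.ofReal_lt_top hy₀top, fun t ht => ?_⟩
  have hyt : ∫⁻ x, ENNReal.ofReal (‖u t x‖ ^ θ) = y t := by rw [hy]
  rw [hyt]
  have ht₀0 : 0 < t₀ := hα.trans_lt ht₀.1
  have htT : t < T := ht.2.trans_le hβ
  -- good restarting times
  have hgood : ∀ᵐ s' ∂(volume.restrict (Ioo 0 T)),
      IsLerayHopfOn (T - s') ν 0 (u s') (fun t => u (t + s')) := hLH.ae_isLerayHopfOn_restart hν.le
  -- a uniform `H¹` bound on the compact `[(α + t₀)/2, t]`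
  have hKsub : Icc ((α + t₀) / 2) t ⊆ Ioo α β := fun s' hs' =>
    ⟨lt_of_lt_of_le (by linarith [ht₀.1]) hs'.1, hs'.2.trans_lt ht.2⟩
  obtain ⟨M, hM, hbound⟩ := hreg.exists_forall_le isCompact_Icc hKsub
  set Am : ℝ := M.toReal with hAm
  have hAm0 : 0 ≤ Am := ENNReal.toReal_nonneg
  set τM : ℝ := c * ν ^ 3 / (Am ^ 2 + 1) with hτM
  have hτM0 : 0 < τM := by positivity
  have hτMc : Am ^ 2 * τM ≤ c * ν ^ 3 := by
    rw [hτM, mul_div_assoc']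
    rw [div_le_iff₀ (by positivity)]
    nlinarith [mul_pos hc (pow_pos hν 3)]
  -- the propagated property
  set A : ℝ → ℝ := fun τ => (∫⁻ σ in Ioo t₀ τ, a σ).toReal with hAdef
  set P : ℝ → Prop := fun τ => y τ ≤ ENNReal.ofReal (Real.exp (κ * A τ)) * y₀ with hPdef
  have hPt : P t := by
    refine forall_Icc_of_local_propagation (a := t₀) (b := t) (P := P) ?_ ?_ t ⟨ht.1, le_rfl⟩
    · simp only [hPdef, hAdef, Ioo_self, Measure.restrict_empty, lintegral_zero_measure,
        ENNReal.toReal_zero, mul_zero, Real.exp_zero, ENNReal.ofReal_one, one_mul, hy₀def, le_refl]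
    · intro σ hσ
      have hσT : σ ≤ T := (hσ.2.trans ht.2.le).trans hβ
      have hlo : 0 ≤ max ((α + t₀) / 2) (σ - τM / 2) := le_max_of_le_left (by linarith)
      have hlt : max ((α + t₀) / 2) (σ - τM / 2) < σ :=
        max_lt (by linarith [hσ.1, ht₀.1]) (by linarith)
      obtain ⟨s', hs', hLHs⟩ := exists_mem_Ioo_of_ae_restrict_Ioo hlo hlt hσT hgood
      have hs1 : (α + t₀) / 2 < s' := (le_max_left _ _).trans_lt hs'.1
      have hs2 : σ - τM / 2 < s' := (le_max_right _ _).trans_lt hs'.1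
      have hs0 : 0 < s' := lt_of_le_of_lt (by linarith) hs1
      have hsT : s' < T := hs'.2.trans_le hσT
      have hsK : s' ∈ Icc ((α + t₀) / 2) t := ⟨hs1.le, hs'.2.le.trans hσ.2⟩
      have hAs : eH1NormSq (u s') ≤ ENNReal.ofReal Am := by
        rw [hAm, ENNReal.ofReal_toReal hM.ne]; exact hbound s' hsK
      set τ' : ℝ := min τM (T - s') with hτ'def
      refine ⟨min (σ - s') (τM / 2), lt_min (sub_pos.2 hs'.2) (by positivity), ?_⟩
      intro τ₁ hτ₁ τ₂ hτ₂ hτ₁σ hτ₁₂ hτ₂σ hP1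
      rcases eq_or_lt_of_le hτ₁₂ with heq | hlt12
      · rw [← heq]; exact hP1
      have hδ1 : min (σ - s') (τM / 2) ≤ σ - s' := min_le_left _ _
      have hδ2 : min (σ - s') (τM / 2) ≤ τM / 2 := min_le_right _ _
      have hsτ₁ : s' < τ₁ := by linarith
      have hτ₂T : τ₂ < T := lt_of_le_of_lt hτ₂.2 htT
      have hτ₂τ' : τ₂ - s' < τ' := by
        refine lt_min (by linarith) ?_
        linarith [hτ₂.2, ht.2, hβ]
      set ε : ℝ := τ₁ - s' with hεdef
      have hε0 : 0 < ε := sub_pos.2 hsτ₁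
      have hετ' : ε < τ' := lt_trans (by rw [hεdef]; linarith) hτ₂τ'
      obtain ⟨w, π, hw, hbw, hbwt, hbπ, hrep⟩ := exists_tao_patch hL2 hν hLH ⟨hs0, hsT⟩ hLHs hAm0
        hAs hτM0 hτMc (ε := ε) ⟨hε0, hετ'⟩
      obtain ⟨hw', hbw', hbwt', hbπ'⟩ := taoSlab_translate hw hbw hbwt hbπ (e := ε) ⟨le_rfl, hετ'⟩
      have hL : 0 < τ' - ε := sub_pos.2 hετ'
      have hrep' : ∀ t' ∈ Icc 0 (τ' - ε), u (t' + τ₁) =ᵐ[volume] w (t' + ε) := by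
        intro t' ht'
        have h := hrep (t' + ε) ⟨by linarith [ht'.1], by linarith [ht'.2]⟩
        have e1 : t' + ε + s' = t' + τ₁ := by rw [hεdef]; ring
        rwa [e1] at h
      have hs12 : τ₂ - τ₁ ∈ Ioc 0 (τ' - ε) := ⟨sub_pos.2 hlt12, by rw [hεdef]; linarith⟩
      have hsub12 : Ioo τ₁ τ₂ ⊆ Ioo 0 T := Ioo_subset_Ioo (by linarith [hτ₁.1]) hτ₂T.le
      have hS' : ∀ t' ∈ Ioo 0 (τ₂ - τ₁), t' + τ₁ ∈ Ico 0 T := fun t' ht' =>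
        ⟨by linarith [ht'.1, hτ₁.1, ht₀0], by linarith [ht'.2]⟩
      have heqw : ∀ t' ∈ Ioo 0 (τ₂ - τ₁), u (t' + τ₁) = (fun t => w (t + ε)) t' := by
        intro t' ht'
        have hcu : Continuous (u (t' + τ₁)) := (hcl.contDiff_velocity (hS' t' ht')).continuous
        have hcw : Continuous (w (t' + ε)) :=
          (hw'.contDiff_velocity ⟨ht'.1.le, ht'.2.le.trans hs12.2⟩).continuous
        exact (Continuous.ae_eq_iff_eq volume hcu hcw).1 (hrep' t' ⟨ht'.1.le, ht'.2.le.trans hs12.2⟩)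
      -- Stein's bound for the patch pressure (the GNS clause, at the dummy pair `(2, 6)`, is unused)
      have hpb := ae_patch_pressure_bounds_of_le hν hL hw' hbw' (hbπ' 0) hcl hs12.2 hS' heqw
        h1mE hmEtop hCS (q := 2) (r := 6) (by norm_num) (by norm_num) (by norm_num)
        (by rw [ENNReal.toReal_ofNat, ENNReal.toReal_ofNat]; norm_num)
      -- the a.e. finiteness of `∇p` slices, translated
      have hLq' : ∀ᵐ t' ∂volume, t' ∈ Ioo 0 (τ₂ - τ₁) →
          eLpNorm (fun x => gradient (p (t' + τ₁)) x) q volume < ⊤ := by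
        filter_upwards [ae_translate_right' hLq τ₁] with t' ht' ht'I
        exact ht' (hsub12 ⟨by linarith [ht'I.1], by linarith [ht'I.2]⟩)
      -- gradient of the patch pressure
      have hgradπ : ∀ t' ∈ Ioo 0 (τ₂ - τ₁),
          (fun x => gradient (π (t' + ε)) x) = fun x => gradient (p (t' + τ₁)) x := by
        intro t' ht'
        have h := gradient_patch_pressure_eq' (π := fun t => π (t + ε)) hw' hcl hs12.2 hS' heqw ht'
        exact h
      -- the hypotheses of the `L^θ` Grönwall inequality on the patch
      have hLqw : ∀ᵐ t' ∂volume, t' ∈ Ioo 0 (τ₂ - τ₁) →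
          eLpNorm (fun x => gradient (π (t' + ε)) x) (ENNReal.ofReal ((θ + 2) / 3)) volume < ⊤ ∧
          eLpNorm (π (t' + ε)) (ENNReal.ofReal ((θ + 2) / 2)) volume ≤
            CS * eLpNorm (w (t' + ε)) (ENNReal.ofReal (θ + 2)) volume ^ 2 := by
        filter_upwards [hpb, hLq'] with t' ht' hfin ht'I
        obtain ⟨hSt, -⟩ := ht' ht'I
        refine ⟨?_, ?_⟩
        · rw [hgradπ t' ht'I, hQq']; exact hfin ht'I
        · rw [← hmE, ← h2mE]; exact hSt
      -- comparison of the weights (equality a.e.)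
      have hwt : ∀ᵐ t' ∂volume, t' ∈ Ioo 0 (τ₂ - τ₁) →
          ENNReal.ofReal ((θ * Real.sqrt ((θ - 2) * CS *
              (∫ x, ‖gradient (π (t' + ε)) x‖ ^ ((θ + 2) / 3)) ^ (1 / ((θ + 2) / 3))) *
            ((SNormLESNormFDerivOfEqConst ℝ (volume : Measure (EuclideanSpace ℝ (Fin 3))) 2 : ℝ) ^ 2 *
                (θ ^ 2 / 4)) ^ (9 / (4 * (θ + 2)))) ^ (1 / Θ)) = a (t' + τ₁) := by
        filter_upwards [hLq'] with t' hfin ht'I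
        have hmem : MemLp (fun x => gradient (p (t' + τ₁)) x) (ENNReal.ofReal ((θ + 2) / 3)) volume := by
          rw [hQq']
          have cg : Continuous fun x => gradient (p (t' + τ₁)) x :=
            (InnerProductSpace.toDual ℝ (EuclideanSpace ℝ (Fin 3))).symm.continuous.comp
              ((hcl.contDiff_pressure (hS' t' ht'I)).continuous_fderiv (by simp))
          exact ⟨cg.aestronglyMeasurable, hfin ht'I⟩
        have hptg : ∀ x, gradient (π (t' + ε)) x = gradient (p (t' + τ₁)) x := fun x =>
          congrFun (hgradπ t' ht'I) x
        have hNeq : (∫ x, ‖gradient (π (t' + ε)) x‖ ^ ((θ + 2) / 3)) ^ (1 / ((θ + 2) / 3)) =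
            N (t' + τ₁) := by
          simp_rw [hptg]
          rw [rpow_integral_norm_rpow_eq_toReal_eLpNorm hQ0 hmem, hQq', hN]
        rw [hNeq, ha]; simp only
        congr 2
        rw [hc₁]
        have hsq : Real.sqrt ((θ - 2) * CS * N (t' + τ₁)) =
            Real.sqrt ((θ - 2) * CS) * Real.sqrt (N (t' + τ₁)) := Real.sqrt_mul' _ (hN0 _)
        rw [hsq]; ring
      have hAeq : ∫⁻ t' in Ioo 0 (τ₂ - τ₁), ENNReal.ofReal ((θ * Real.sqrt ((θ - 2) * CS *
              (∫ x, ‖gradient (π (t' + ε)) x‖ ^ ((θ + 2) / 3)) ^ (1 / ((θ + 2) / 3))) *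
            ((SNormLESNormFDerivOfEqConst ℝ (volume : Measure (EuclideanSpace ℝ (Fin 3))) 2 : ℝ) ^ 2 *
                (θ ^ 2 / 4)) ^ (9 / (4 * (θ + 2)))) ^ (1 / Θ)) = ∫⁻ σ' in Ioo τ₁ τ₂, a σ' := by
        calc _ = ∫⁻ t' in Ioo 0 (τ₂ - τ₁), a (t' + τ₁) := by
              refine setLIntegral_congr_fun_ae measurableSet_Ioo ?_
              filter_upwards [hwt] with t' ht' ht'I
              exact ht' ht'I
          _ = ∫⁻ σ' in Ioo τ₁ τ₂, a σ' := by
              rw [setLIntegral_Ioo_comp_add_right a 0 (τ₂ - τ₁) τ₁, zero_add, sub_add_cancel]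
      have hfin12 : ∫⁻ σ' in Ioo τ₁ τ₂, a σ' ≠ ⊤ := ne_top_of_le_ne_top hA' (lintegral_mono_set hsub12)
      have hAfin : ∫⁻ t' in Ioo 0 (τ₂ - τ₁), ENNReal.ofReal ((θ * Real.sqrt ((θ - 2) * CS *
              (∫ x, ‖gradient (π (t' + ε)) x‖ ^ ((θ + 2) / 3)) ^ (1 / ((θ + 2) / 3))) *
            ((SNormLESNormFDerivOfEqConst ℝ (volume : Measure (EuclideanSpace ℝ (Fin 3))) 2 : ℝ) ^ 2 *
                (θ ^ 2 / 4)) ^ (9 / (4 * (θ + 2)))) ^ (1 / Θ)) ≠ ⊤ := by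
        rw [hAeq]; exact hfin12
      -- the `L^θ` Grönwall inequality on the translated slab
      have hineq := ltheta_energy_le_mul_exp hν hL hw' hbw' hbwt' hbπ' hθ4 hΘ hs12 hLqw hAfin
      rw [hAeq] at hineq
      have hy2 : y τ₂ = ∫⁻ x, ENNReal.ofReal (‖w (τ₂ - τ₁ + ε) x‖ ^ θ) := by
        rw [hy]
        refine lintegral_congr_ae ?_
        have h := hrep' (τ₂ - τ₁) ⟨hs12.1.le, hs12.2⟩
        rw [sub_add_cancel] at h
        filter_upwards [h] with x hx
        rw [hx]
      have hy1 : y τ₁ = ∫⁻ x, ENNReal.ofReal (‖w (0 + ε) x‖ ^ θ) := by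
        rw [hy]
        refine lintegral_congr_ae ?_
        have h := hrep' 0 ⟨le_rfl, hL.le⟩
        rw [zero_add τ₁] at h
        filter_upwards [h] with x hx
        rw [hx]
      have hstep : y τ₂ ≤ ENNReal.ofReal (Real.exp (κ * (∫⁻ σ' in Ioo τ₁ τ₂, a σ').toReal)) * y τ₁ := by
        rw [hy2, hy1, hκ]
        exact hineq
      have hfin02 : ∫⁻ σ' in Ioo t₀ τ₂, a σ' ≠ ⊤ :=
        ne_top_of_le_ne_top hA' (lintegral_mono_set (Ioo_subset_Ioo ht₀0.le hτ₂T.le))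
      exact exp_lintegral_chain (y := y) (a := a) (C := κ) (y₀ := y₀) hτ₁.1 hτ₁₂ hfin02 hP1 hstep
  -- conclusion
  refine hPt.trans (mul_le_mul_left (ENNReal.ofReal_le_ofReal (Real.exp_le_exp.2
    (mul_le_mul_of_nonneg_left ?_ hκ0))) _)
  exact ENNReal.toReal_mono hA' (lintegral_mono_set (Ioo_subset_Ioo ht₀0.le htT.le))

end StepA3

/-! ### Step B (`q ≥ 3`): the continuation hypothesis from a uniform `L^θ` bound -/

section StepB3

variable {ν T : ℝ} {u₀ : EuclideanSpace ℝ (Fin 3) → EuclideanSpace ℝ (Fin 3)}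
  {u : ℝ → EuclideanSpace ℝ (Fin 3) → EuclideanSpace ℝ (Fin 3)}

/-- **The Serrin integral `∫‖u‖_{L^θ}^{2θ/(θ-3)}` of a translate with bounded `L^θ` energy is
finite** (`θ > 3`; Serrin pair `(2θ/(θ-3), θ)`). [folklore] -/
private theorem lintegral_serrin_rpow_ne_top_of_ltheta_bound {s L : ℝ} {K : ℝ≥0∞} (hK : K < ⊤)
    {θ : ℝ} (hθ : 3 < θ)
    (hbd : ∀ t ∈ Ioo 0 L, ∫⁻ x, ENNReal.ofReal (‖u (t + s) x‖ ^ θ) ≤ K) :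
    ∫⁻ t in Ioo 0 L, ENNReal.ofReal ((eLpNorm (u (t + s)) (ENNReal.ofReal θ) volume).toReal ^
      (2 / (1 - (3 / ENNReal.ofReal θ).toReal))) ≠ ⊤ := by
  have hθ0 : 0 < θ := by linarith
  set Mr : ℝ := (K ^ (1 / θ)).toReal with hMr
  have h3θ : (3 / ENNReal.ofReal θ).toReal = 3 / θ := by
    rw [ENNReal.toReal_div, ENNReal.toReal_ofNat, ENNReal.toReal_ofReal hθ0.le]
  have hexp0 : 0 ≤ 2 / (1 - (3 / ENNReal.ofReal θ).toReal) := by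
    rw [h3θ]
    have : 3 / θ < 1 := by rw [div_lt_one hθ0]; exact hθ
    exact div_nonneg (by norm_num) (by linarith)
  have hθE0 : ENNReal.ofReal θ ≠ 0 := (ENNReal.ofReal_pos.2 hθ0).ne'
  have hslice : ∀ t ∈ Ioo 0 L, (eLpNorm (u (t + s)) (ENNReal.ofReal θ) volume).toReal ≤ Mr := by
    intro t ht
    have h4 : eLpNorm (u (t + s)) (ENNReal.ofReal θ) volume =
        (∫⁻ x, ‖u (t + s) x‖ₑ ^ θ) ^ (1 / θ) := by
      rw [eLpNorm_eq_lintegral_rpow_enorm_toReal hθE0 ENNReal.ofReal_ne_top, ENNReal.toReal_ofReal hθ0.le]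
    have hconv : ∫⁻ x, ‖u (t + s) x‖ₑ ^ θ = ∫⁻ x, ENNReal.ofReal (‖u (t + s) x‖ ^ θ) :=
      lintegral_congr fun x => by
        rw [← ofReal_norm, ENNReal.ofReal_rpow_of_nonneg (norm_nonneg _) hθ0.le]
    rw [hMr, h4, hconv]
    exact ENNReal.toReal_mono (ENNReal.rpow_ne_top_of_nonneg (by positivity) hK.ne)
      (ENNReal.rpow_le_rpow (hbd t ht) (by positivity))
  refine ne_top_of_le_ne_top (b := ∫⁻ _ in Ioo 0 L, ENNReal.ofReal
    (Mr ^ (2 / (1 - (3 / ENNReal.ofReal θ).toReal)))) ?_ ?_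
  · rw [setLIntegral_const]
    exact ENNReal.mul_ne_top ENNReal.ofReal_ne_top (by simp [Real.volume_Ioo])
  · refine setLIntegral_mono_ae measurable_const.aemeasurable ?_
    refine Eventually.of_forall fun t ht => ENNReal.ofReal_le_ofReal ?_
    exact Real.rpow_le_rpow ENNReal.toReal_nonneg (hslice t ht) hexp0

/-- **A Leray–Hopf solution with bounded `L^θ` energy (`θ > 3`) near the right end `β` of an
interval of `H¹`-regularity keeps `limsup_{t → β⁻} ‖u(t)‖²_{H¹} < ∞`** (restart at a good time and
`limsup_eH1NormSq_lt_top_of_serrin` in the Serrin class `L^{2θ/(θ-3)}_t L^θ_x`); the `L^θ` twin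
of `limsup_eH1NormSq_lt_top_of_lfour_bound_near`.
[cite: RobinsonRodrigoSadowski2016, Thm. 8.17 and Lemma 8.16 (proof)] -/
theorem limsup_eH1NormSq_lt_top_of_ltheta_bound_near (hν : 0 < ν) (hLH : IsLerayHopfOn T ν 0 u₀ u)
    {α β : ℝ} (hα : 0 ≤ α) (hαβ : α < β) (hβ : β ≤ T) (hreg : IsH1RegularOn (Ioo α β) u)
    {θ : ℝ} (hθ : 3 < θ) {δ : ℝ} {K : ℝ≥0∞} (hδ : 0 < δ) (hK : K < ⊤)
    (hbd : ∀ t ∈ Ioo (β - δ) β, ∫⁻ x, ENNReal.ofReal (‖u t x‖ ^ θ) ≤ K) :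
    limsup (fun t => eH1NormSq (u t)) (𝓝[<] β) < ⊤ := by
  obtain ⟨c, hc, hL2⟩ := tao2011_H1_local_almost_regular_holds
  have h3r : (3 : ℝ≥0∞) < ENNReal.ofReal θ := by
    rw [show (3 : ℝ≥0∞) = ENNReal.ofReal 3 by norm_num]
    exact (ENNReal.ofReal_lt_ofReal_iff (by linarith)).2 hθ
  set a : ℝ := max α (β - δ) with ha
  have ha0 : 0 ≤ a := hα.trans (le_max_left _ _)
  have haβ : a < β := max_lt hαβ (by linarith)
  obtain ⟨s, hs, hLHs⟩ := hLH.exists_isLerayHopfOn_restart_Ioo hν.le ha0 haβ hβ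
  have hαs : α < s := (le_max_left _ _).trans_lt hs.1
  have hδs : β - δ < s := (le_max_right _ _).trans_lt hs.1
  have hLHw : IsLerayHopfOn (β - s) ν 0 (u s) (fun t => u (t + s)) := hLHs.of_le (by linarith)
  have hregw : IsH1RegularOn (Ioo 0 (β - s)) (fun t => u (t + s)) := by
    have h := hreg.comp_add_right s
    exact h.mono (Ioo_subset_Ioo (by linarith) le_rfl)
  have hA := lintegral_serrin_rpow_ne_top_of_ltheta_bound (u := u) (s := s) (L := β - s) hK hθ
    fun t ht => hbd (t + s) ⟨by linarith [ht.1], by linarith [ht.2]⟩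
  have hlim : limsup (fun t => eH1NormSq (u (t + s))) (𝓝[<] (β - s)) < ⊤ :=
    limsup_eH1NormSq_lt_top_of_serrin hL2 hc hν hLHw h3r hA le_rfl (sub_pos.2 hs.2) le_rfl hregw
  set L : ℝ≥0∞ := limsup (fun t => eH1NormSq (u (t + s))) (𝓝[<] (β - s)) with hL
  have hL1 : L < L + 1 := ENNReal.lt_add_right hlim.ne one_ne_zero
  have hev : ∀ᶠ t in 𝓝[<] (β - s), eH1NormSq (u (t + s)) < L + 1 :=
    Filter.eventually_lt_of_limsup_lt hL1
  obtain ⟨l, hl, hsub⟩ := mem_nhdsLT_iff_exists_Ioo_subset.1 hev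
  have hev' : ∀ᶠ t in 𝓝[<] β, eH1NormSq (u t) ≤ L + 1 := by
    filter_upwards [Ioo_mem_nhdsLT (show l + s < β by linarith [mem_Iio.1 hl])] with t ht
    have h := hsub (show t - s ∈ Ioo l (β - s) from ⟨by linarith [ht.1], by linarith [ht.2]⟩)
    simp only [mem_setOf_eq, sub_add_cancel] at h
    exact h.le
  exact lt_of_le_of_lt (Filter.limsup_le_of_le (by isBoundedDefault) hev')
    (ENNReal.add_lt_top.2 ⟨hlim, ENNReal.one_lt_top⟩)

/-- **Some slice in every interval of a Leray–Hopf solution is in `L^θ`** (`θ ≥ 2`): on an open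
interval `(α, β) ⊆ (0, T)` of `H¹`-regularity there is `t₀ ∈ (α, β)` with `∫|u(t₀)|^θ < ∞` —
a slice of a Tao patch (bounded and in `L²`). [cite: Tao2011, Lemma 2.3 / Prop. 2.4] -/
theorem exists_mem_Ioo_lintegral_norm_rpow_lt_top {c : ℝ} (hL2 : TaoH1AlmostRegularWith c)
    (hc : 0 < c) (hν : 0 < ν) (hLH : IsLerayHopfOn T ν 0 u₀ u)
    {α β : ℝ} (hα : 0 ≤ α) (hαβ : α < β) (hβ : β ≤ T) (hreg : IsH1RegularOn (Ioo α β) u)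
    {θ : ℝ} (hθ : 2 ≤ θ) :
    ∃ t₀ ∈ Ioo α β, ∫⁻ x, ENNReal.ofReal (‖u t₀ x‖ ^ θ) < ⊤ := by
  -- a good time `s' ∈ (α, (α+β)/2)` with an `H¹` bound
  have hgood : ∀ᵐ s' ∂(volume.restrict (Ioo 0 T)),
      IsLerayHopfOn (T - s') ν 0 (u s') (fun t => u (t + s')) := hLH.ae_isLerayHopfOn_restart hν.le
  have hKsub : Icc ((3 * α + β) / 4) ((α + β) / 2) ⊆ Ioo α β := fun s' hs' =>
    ⟨lt_of_lt_of_le (by linarith) hs'.1, lt_of_le_of_lt hs'.2 (by linarith)⟩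
  obtain ⟨M, hM, hbound⟩ := hreg.exists_forall_le isCompact_Icc hKsub
  set Am : ℝ := M.toReal with hAm
  have hAm0 : 0 ≤ Am := ENNReal.toReal_nonneg
  set τM : ℝ := c * ν ^ 3 / (Am ^ 2 + 1) with hτM
  have hτM0 : 0 < τM := by positivity
  have hτMc : Am ^ 2 * τM ≤ c * ν ^ 3 := by
    rw [hτM, mul_div_assoc']
    rw [div_le_iff₀ (by positivity)]
    nlinarith [mul_pos hc (pow_pos hν 3)]
  have hlo : 0 ≤ (3 * α + β) / 4 := by linarith
  have hlt : (3 * α + β) / 4 < (α + β) / 2 := by linarith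
  have hmidT : (α + β) / 2 ≤ T := by linarith
  obtain ⟨s', hs', hLHs⟩ := exists_mem_Ioo_of_ae_restrict_Ioo hlo hlt hmidT hgood
  have hs0 : 0 < s' := lt_of_le_of_lt hlo hs'.1
  have hsT : s' < T := lt_of_lt_of_le hs'.2 hmidT
  have hAs : eH1NormSq (u s') ≤ ENNReal.ofReal Am := by
    rw [hAm, ENNReal.ofReal_toReal hM.ne]; exact hbound s' ⟨hs'.1.le, hs'.2.le⟩
  set τ' : ℝ := min τM (T - s') with hτ'def
  have hτ' : 0 < τ' := lt_min hτM0 (sub_pos.2 hsT)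
  -- the patch and a time inside it, below `β`
  set ε : ℝ := min (τ' / 2) ((β - s') / 2) with hε
  have hβs : 0 < β - s' := by linarith [hs'.2]
  have hε0 : 0 < ε := lt_min (by positivity) (by positivity)
  have hετ' : ε < τ' := lt_of_le_of_lt (min_le_left _ _) (by linarith)
  obtain ⟨w, π, hw, hbw, -, -, hrep⟩ := exists_tao_patch hL2 hν hLH ⟨hs0, hsT⟩ hLHs hAm0
    hAs hτM0 hτMc (ε := ε) ⟨hε0, hετ'⟩
  obtain ⟨B₀, hB₀⟩ := linfty_bound_of_hasBoundedSobolevNormsOn_holds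
    (fun t ht => (hw.contDiff_velocity ht).of_le (by norm_cast)) hbw
  obtain ⟨C₀, hC₀⟩ := hbw 0
  have hεI : ε ∈ Icc ε (min τM (T - s')) := ⟨le_rfl, hετ'.le⟩
  refine ⟨ε + s', ⟨by linarith [hs'.1], ?_⟩, ?_⟩
  · have : ε ≤ (β - s') / 2 := min_le_right _ _
    linarith
  · have hae := hrep ε hεI
    have hw2 : ∫⁻ x, ‖w ε x‖ₑ ^ 2 < ⊤ := by
      refine lt_of_le_of_lt ((le_of_eq (lintegral_congr fun x => ?_)).trans (hC₀ ε hεI))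
        ENNReal.coe_lt_top
      rw [← ofReal_norm, ← ofReal_norm, norm_iteratedFDeriv_zero]
    have h := lintegral_ofReal_norm_rpow_lt_top_of_bound (hB₀ ε hεI) hw2 hθ
    refine lt_of_le_of_lt (le_of_eq (lintegral_congr_ae ?_)) h
    filter_upwards [hae] with x hx
    rw [hx]

end StepB3

/-! ### The discharge for `q ≥ 3` and the full criterion -/

section Discharge3

/-- **The pressure-gradient regularity criterion on `ℝ³`, case `3 ≤ q < ∞`, PROVED**
(Lemarié-Rieusset 2016, Prop. 11.7 with `σ = 2`, the half `q ∈ [3, ∞)`; `L^θ` energy with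
`θ = 3q - 2`). [cite: LemarieRieusset2016, §11.5 Prop. 11.7 (PDF pp. 365–366)]
[cite: BerselliGaldi2002, Thm. 3.3 p. 3593] -/
theorem pressureGradientCriterion_of_three_le (ν T : ℝ) (hν : 0 < ν) (hT : 0 < T)
    (u : ℝ → EuclideanSpace ℝ (Fin 3) → EuclideanSpace ℝ (Fin 3))
    (p : ℝ → EuclideanSpace ℝ (Fin 3) → ℝ)
    (hcl : IsClassicalNSSolutionOn (Ico 0 T) ν 0 u p) (hLH : IsLerayHopfOn T ν 0 (u 0) u)
    (s q : ℝ≥0∞) (h3q : 3 ≤ q) (hqtop : q < ⊤) (hsq : 2 / s + 3 / q = 3)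
    (hS : MemLqLp s q (fun t x => gradient (p t) x) (Ioo 0 T)) :
    HasSmoothExtensionPast ν 0 u T := by
  obtain ⟨c, hc, hL2⟩ := tao2011_H1_local_almost_regular_holds
  obtain ⟨hθ4, -, -, -, -⟩ := pressureGradient_exponents_three_le h3q hqtop hsq
  -- Stein's constant at exponent `(θ+2)/2`
  have h1m : 1 < ENNReal.ofReal ((3 * q.toReal - 2 + 2) / 2) := by
    rw [← ENNReal.ofReal_one]; exact (ENNReal.ofReal_lt_ofReal_iff (by linarith)).2 (by linarith)
  obtain ⟨CS, hCS⟩ := exists_eLpNorm_normalisedPressure_le_sq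
    (p := ENNReal.ofReal ((3 * q.toReal - 2 + 2) / 2)) h1m ENNReal.ofReal_lt_top
  have hM0 : 0 ≤ (3 * q.toReal - 2) * Real.sqrt ((3 * q.toReal - 2 - 2) * CS) *
      ((SNormLESNormFDerivOfEqConst ℝ (volume : Measure (EuclideanSpace ℝ (Fin 3))) 2 : ℝ) ^ 2 *
        ((3 * q.toReal - 2) ^ 2 / 4)) ^ (9 / (4 * (3 * q.toReal - 2 + 2))) := by
    have : 0 ≤ 3 * q.toReal - 2 := by linarith
    positivity
  obtain ⟨hA1, hLq⟩ := lintegral_ofReal_rpow_pressureGradient_lt_top_three_le h3q hqtop hsq hS hM0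
  -- `u` is `H¹`-regular on `(0, T]`
  have hregT : IsH1RegularOn (Ioc 0 T) u := by
    refine leray_continuation_H1_holds ν T hν hT (u 0) u hLH fun α β hα hαβ hβ hregI => ?_
    obtain ⟨t₀, ht₀m, hy₀⟩ := exists_mem_Ioo_lintegral_norm_rpow_lt_top hL2 hc hν hLH hα hαβ hβ
      hregI (θ := 3 * q.toReal - 2) (by linarith)
    obtain ⟨K, hK, hbd⟩ := exists_ltheta_le_of_pressureGradient hL2 hc hν hLH hcl h3q hqtop hsq hLq
      hCS hA1.ne hα hβ hregI ht₀m hy₀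
    exact limsup_eH1NormSq_lt_top_of_ltheta_bound_near hν hLH hα hαβ hβ hregI
      (θ := 3 * q.toReal - 2) (by linarith) (δ := β - t₀) (sub_pos.2 ht₀m.2) hK
      fun t ht => hbd t ⟨by linarith [ht.1], ht.2⟩
  -- `‖u(t)‖²_{H¹} ≤ A < ∞` on `[T/2, T]`
  have hreg : IsH1RegularOn (Icc (T / 2) T) u :=
    hregT.mono fun t ht => ⟨by linarith [ht.1], ht.2⟩
  obtain ⟨A, hAtop, hAle⟩ := hreg.exists_forall_le isCompact_Icc subset_rfl
  obtain ⟨c', hc', hlocc⟩ := leray_local_strong_H1_holds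
  have hLPS : ladyzhenskaya_prodi_serrin := ladyzhenskaya_prodi_serrin_holds
  set a : ℝ := A.toReal with ha
  have ha0 : 0 ≤ a := ENNReal.toReal_nonneg
  set τ : ℝ := c' * ν ^ 3 / (a ^ 2 + 1) with hτ
  have hcν : 0 < c' * ν ^ 3 := mul_pos hc' (pow_pos hν 3)
  have hτpos : 0 < τ := div_pos hcν (by positivity)
  have hτc : a ^ 2 * τ ≤ c' * ν ^ 3 := by
    have h1 : a ^ 2 * τ = c' * ν ^ 3 * (a ^ 2 / (a ^ 2 + 1)) := by
      rw [hτ]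
      ring
    rw [h1]
    exact mul_le_of_le_one_right hcν.le (div_le_one_of_le₀ (by linarith) (by positivity))
  set s₀ : ℝ := max (T / 2) (T - τ / 2) with hs₀
  have hs₀0 : 0 ≤ s₀ := le_max_of_le_left (by linarith)
  have hs₀T : s₀ < T := max_lt (by linarith) (by linarith)
  obtain ⟨s', hs', hLHs⟩ := hLH.exists_isLerayHopfOn_restart_Ioo hν.le hs₀0 hs₀T le_rfl
  have hsT2 : T / 2 ≤ s' := (le_max_left _ _).trans hs'.1.le
  have hsτ : T < s' + τ := by
    have h1 : T - τ / 2 < s' := (le_max_right _ _).trans_lt hs'.1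
    linarith
  have hs0 : 0 < s' := by linarith
  have hTs : 0 < T - s' := sub_pos.2 hs'.2
  have hTsτ : T - s' ≤ τ := by linarith
  have hu2 : MemLp (u s') 2 volume := hLH.memLp s' ⟨hs0.le, hs'.2.le⟩
  have hdiv : IsWeaklyDivFree (u s') := hLHs.isWeaklyDivFree_datum hTs
  have hgrad : eWeakGradL2Sq (u s') ≤ ENNReal.ofReal a := by
    calc eWeakGradL2Sq (u s') ≤ eH1NormSq (u s') := le_add_self
      _ ≤ A := hAle s' ⟨hsT2, hs'.2.le⟩
      _ = ENNReal.ofReal a := (ENNReal.ofReal_toReal hAtop.ne).symm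
  obtain ⟨v, hv, hv0, hvreg⟩ := hlocc hν hτpos hu2 hdiv ha0 hgrad hτc
  have hvS : MemLqLp ∞ 6 v (Ioo 0 τ) :=
    memLqLp_top_six_of_isH1RegularOn_Icc hvreg fun t ht => hv.memLp t ht
  have hr6 : (3 : ℝ≥0∞) < 6 := by norm_num
  have hqr6 : 2 / (∞ : ℝ≥0∞) + 3 / (6 : ℝ≥0∞) ≤ 1 := by
    rw [ENNReal.div_top, zero_add]
    exact ENNReal.div_le_of_le_mul (by norm_num)
  obtain ⟨V, P, hVP, hvV⟩ := hLPS hν hτpos hv hr6 hqr6 hvS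
  have hae : ∀ t ∈ Ioc 0 (T - s'), (fun t => u (t + s')) t =ᵐ[volume] v t :=
    serrin_weak_strong_uniqueness_holds hν hTs (hv.of_le hTsτ) hu2 (q := ∞) (r := 6) hr6
      hqr6 (hvS.mono_set (Ioo_subset_Ioo_right hTsτ)) hLHs
  have heq : ∀ t ∈ Ioo s' T, u t = V (t + -s') := by
    intro t ht
    have hts : t - s' ∈ Ioc 0 (T - s') := ⟨sub_pos.2 ht.1, by linarith [ht.2]⟩
    have h1 : u t =ᵐ[volume] v (t - s') := by
      have h := hae (t - s') hts
      simpa only [sub_add_cancel] using h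
    have h2 : v (t - s') =ᵐ[volume] V (t - s') := hvV (t - s') ⟨hts.1, hts.2.trans hTsτ⟩
    have hcu : Continuous (u t) :=
      (hcl.contDiff_velocity ⟨hs0.le.trans ht.1.le, ht.2⟩).continuous
    have hcV : Continuous (V (t - s')) :=
      (hVP.contDiff_velocity ⟨hts.1, hts.2.trans hTsτ⟩).continuous
    rw [← sub_eq_add_neg]
    exact (Continuous.ae_eq_iff_eq volume hcu hcV).1 (h1.trans h2)
  have h₂ : IsClassicalNSSolutionOn (Ioo s' (s' + τ)) ν 0 (fun t => V (t + -s'))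
      (fun t => P (t + -s')) := by
    have hVP' := hVP.comp_add_right (-s')
    have h0 : (fun t => (0 : ℝ → EuclideanSpace ℝ (Fin 3) → EuclideanSpace ℝ (Fin 3)) (t + -s')) = 0 :=
      rfl
    rw [h0] at hVP'
    exact hVP'.mono (fun t ht => ⟨by simp only [mem_Ioo] at ht ⊢; linarith [ht.1],
      by simp only [mem_Ioo] at ht ⊢; linarith [ht.2]⟩) isOpen_Ioo.uniqueDiffOn
  exact ⟨s' + τ, hsτ, _, _, hcl.glue h₂ hs0.le hs'.2 hsτ.le heq, fun t ht => by
    simp only [if_pos ht.2]⟩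

/-- **The pressure-gradient regularity criterion on `ℝ³`, DISCHARGED** (Berselli–Galdi 2002,
Thm. 3.3 / Zhou; Lemarié-Rieusset 2016, Prop. 11.7 with `σ = 2`): the named fact
`Literature.Analysis.FluidPDE.pressureGradientCriterion` holds — a classical solution of the
unforced Navier–Stokes system on `ℝ³ × [0, T)` which is Leray–Hopf from `u(0)` and whose pressure
gradient lies in `L^s(0, T; L^q)`, `2/s + 3/q = 3`, `1 < q < ∞`, extends smoothly past `T`
(cases `q < 3`: `pressureGradientCriterion_of_lt_three`, `L⁴` energy; `q ≥ 3`: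
`pressureGradientCriterion_of_three_le`, `L^{3q-2}` energy). The decay and pressure-normalisation
hypotheses of the fact are not needed. [cite: LemarieRieusset2016, §11.5 Prop. 11.7 (PDF pp. 362–366)]
[cite: BerselliGaldi2002, Thm. 3.3 p. 3593] -/
theorem pressureGradientCriterion_holds : pressureGradientCriterion := by
  intro ν T hν hT u p hcl hLH _ _ s q h1q hqtop hsq hS
  rcases lt_or_ge q 3 with hq3 | h3q
  · exact pressureGradientCriterion_of_lt_three ν T hν hT u p hcl hLH s q h1q hq3 hsq hS
  · exact pressureGradientCriterion_of_three_le ν T hν hT u p hcl hLH s q h3q hqtop hsq hS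

end Discharge3

end Literature.Analysis.FluidPDE

end
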